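import Summits.HodgeConjecture.CorCM.IrreducibleOddWeightsCommutantBicommutant
import HarnessLib

/-!
# Density over the commutant, XIV: THE CENTRE `Z = 𝒟 ∩ ℬ` — on `A` it is `𝒟|_A ∩ span(T)|_A`, it is commutative and
# closed under inverses, and a COMMUTATIVE commutant lies INSIDE the operator algebra: `𝒟|_A ⊆ span(T)|_A`

COR-CM (cell `pub-hodgecm2`, binder seat `b16` gen 74, count-neutral claim THE CENTRE (gen 73 successor menu (c)),
file Z1 — abstract linear algebra over `ℚ`; theorems only, no definition, no named fact, no `sorry`).  NEW as stated,
hence under `Summits/`.  HONEST FRAMING: the elementary half of the double-centralizer formalism for ONE finite-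
dimensional stable irreducible `A ≤ V` of a family of operators `T` closed under composition with identity, with
commutant `𝒟` and bicommutant `ℬ` carried as PARAMETERS with their characterising hypotheses (gen 72 C1
`exists_commutant`, gen 73 K2 `exists_bicommutant`); the CENTRE is simply `𝒟 ⊓ ℬ` (no definition).  On the CM side
(`T_k` = translation by `k ∈ G` on `ℚ^Y`, `A` an irreducible odd constituent) `span(T)|_A` is the image of `ℚ[G]`
and `𝒟` the endomorphism algebra of the corresponding simple factor up to isogeny; nothing about Hodge classes is
asserted, `HC_CM` is neither used nor asserted.

* §1 `mem_commutant_inf_bicommutant_iff` (`z ∈ 𝒟 ⊓ ℬ ⟺ z ∈ 𝒟` and `z` commutes with `𝒟` on `A`),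
  `commutant_inf_bicommutant_apply_comm` (the centre is COMMUTATIVE on `A`), **`map_domRestrict'_commutant_inf_bicommutant_eq`:
  `(𝒟 ⊓ ℬ)|_A = 𝒟|_A ⊓ ℬ|_A`** and, by K2's `ℬ|_A = span(T)|_A`, **`map_domRestrict'_centre_eq_inf_span`:
  `(𝒟 ⊓ ℬ)|_A = 𝒟|_A ⊓ span(T)|_A`** — the centre is the intersection of the operator algebra with its commutant;
  `domRestrict'_mem_centre_iff_of_mem_span` (an element of `span(T)` is central iff it commutes with the `T_i` on `A`).
* §2 SCHUR FOR THE CENTRE: `centre_zero_or_injOn`, **`exists_centre_inverse`** (a central element non-zero on `A`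
  has an inverse IN THE CENTRE) — `Z|_A` is a field.
* §3 COMMUTATIVE COMMUTANTS: **`map_domRestrict'_commutant_le_span_iff_comm`: `𝒟|_A ≤ span(T)|_A ⟺ 𝒟` is
  commutative on `A`** (then `𝒟 ≤ ℬ` and the centre is all of `𝒟|_A`: `map_domRestrict'_centre_eq_of_comm`); bounds
  `finrank_map_domRestrict'_centre_le` (`dim Z|_A ≤ δ`), `finrank_map_domRestrict'_centre_le_span`.

## References

* [CurtisReiner1962] C. W. Curtis, I. Reiner, *Representation Theory of Finite Groups and Associative Algebras*,
  §27 (27.3), §59 (double centralizer).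
* [Lang2002] S. Lang, *Algebra*, 3rd ed., XVII §1 Prop. 1.1 (Schur), XVII §3 Thm. 3.2, Cor. 3.5.
* [Herstein1994] I. N. Herstein, *Noncommutative Rings*, Carus Math. Monographs 15 (reprint 1994), §4 (simple algebras; the centre).
-/

set_option autoImplicit false

noncomputable section

open scoped BigOperators Classical

universe v w

namespace Summit.HodgeConjecture.CorCM.IrrOdd

variable {V : Type v} [AddCommGroup V] [Module ℚ V] {ι : Type w} (T : ι → V →ₗ[ℚ] V)

/-! ### §1 The centre and its restriction to `A` -/

omit [AddCommGroup V] [Module ℚ V] in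
/-- **`z ∈ 𝒟 ⊓ ℬ ⟺ z ∈ 𝒟 ∧ z` commutes with every `L ∈ 𝒟` on `A`** (a member of `𝒟` already preserves `A`).
[cite: CurtisReiner1962, §59] -/
theorem mem_commutant_inf_bicommutant_iff [AddCommGroup V] [Module ℚ V] (T : ι → V →ₗ[ℚ] V)
    {𝒟 ℬ : Submodule ℚ (V →ₗ[ℚ] V)} {A : Submodule ℚ V}
    (h𝒟 : ∀ L : V →ₗ[ℚ] V, L ∈ 𝒟 ↔ (∀ a ∈ A, L a ∈ A) ∧ ∀ (i : ι) (a : V), a ∈ A → L (T i a) = T i (L a))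
    (hℬ : ∀ ψ : V →ₗ[ℚ] V, ψ ∈ ℬ ↔ (∀ a ∈ A, ψ a ∈ A) ∧
      ∀ (L : ↥𝒟) (a : V), a ∈ A → ψ ((L : V →ₗ[ℚ] V) a) = (L : V →ₗ[ℚ] V) (ψ a))
    (z : V →ₗ[ℚ] V) :
    z ∈ 𝒟 ⊓ ℬ ↔ z ∈ 𝒟 ∧ ∀ L ∈ 𝒟, ∀ a ∈ A, z (L a) = L (z a) := by
  rw [Submodule.mem_inf]
  constructor
  · rintro ⟨hz𝒟, hzℬ⟩
    exact ⟨hz𝒟, fun L hL a ha => ((hℬ z).1 hzℬ).2 ⟨L, hL⟩ a ha⟩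
  · rintro ⟨hz𝒟, hzc⟩
    exact ⟨hz𝒟, (hℬ z).2 ⟨((h𝒟 z).1 hz𝒟).1, fun L a ha => hzc L L.2 a ha⟩⟩

omit [AddCommGroup V] [Module ℚ V] in
/-- **THE CENTRE IS COMMUTATIVE ON `A`**: `z (z′ a) = z′ (z a)` for `z, z′ ∈ 𝒟 ⊓ ℬ`, `a ∈ A`.
[cite: CurtisReiner1962, §59] [cite: Herstein1994, §4] -/
theorem commutant_inf_bicommutant_apply_comm [AddCommGroup V] [Module ℚ V] (T : ι → V →ₗ[ℚ] V)
    {𝒟 ℬ : Submodule ℚ (V →ₗ[ℚ] V)} {A : Submodule ℚ V}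
    (h𝒟 : ∀ L : V →ₗ[ℚ] V, L ∈ 𝒟 ↔ (∀ a ∈ A, L a ∈ A) ∧ ∀ (i : ι) (a : V), a ∈ A → L (T i a) = T i (L a))
    (hℬ : ∀ ψ : V →ₗ[ℚ] V, ψ ∈ ℬ ↔ (∀ a ∈ A, ψ a ∈ A) ∧
      ∀ (L : ↥𝒟) (a : V), a ∈ A → ψ ((L : V →ₗ[ℚ] V) a) = (L : V →ₗ[ℚ] V) (ψ a))
    {z z' : V →ₗ[ℚ] V} (hz : z ∈ 𝒟 ⊓ ℬ) (hz' : z' ∈ 𝒟 ⊓ ℬ) {a : V} (ha : a ∈ A) :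
    z (z' a) = z' (z a) :=
  ((mem_commutant_inf_bicommutant_iff T h𝒟 hℬ z).1 hz).2 z' (Submodule.mem_inf.1 hz').1 a ha

omit [AddCommGroup V] [Module ℚ V] in
/-- Membership in `ℬ` depends only on the values on `A`: a member of `𝒟` agreeing on `A` with a member of `ℬ` is
central. [cite: CurtisReiner1962, §59] -/
theorem mem_bicommutant_of_eqOn [AddCommGroup V] [Module ℚ V] (T : ι → V →ₗ[ℚ] V)
    {𝒟 ℬ : Submodule ℚ (V →ₗ[ℚ] V)} {A : Submodule ℚ V}
    (h𝒟 : ∀ L : V →ₗ[ℚ] V, L ∈ 𝒟 ↔ (∀ a ∈ A, L a ∈ A) ∧ ∀ (i : ι) (a : V), a ∈ A → L (T i a) = T i (L a))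
    (hℬ : ∀ ψ : V →ₗ[ℚ] V, ψ ∈ ℬ ↔ (∀ a ∈ A, ψ a ∈ A) ∧
      ∀ (L : ↥𝒟) (a : V), a ∈ A → ψ ((L : V →ₗ[ℚ] V) a) = (L : V →ₗ[ℚ] V) (ψ a))
    {z ψ : V →ₗ[ℚ] V} (hz : z ∈ 𝒟) (hψ : ψ ∈ ℬ) (heq : ∀ a ∈ A, z a = ψ a) : z ∈ ℬ := by
  refine (hℬ z).2 ⟨((h𝒟 z).1 hz).1, fun L a ha => ?_⟩
  have hLa : (L : V →ₗ[ℚ] V) a ∈ A := ((h𝒟 L).1 L.2).1 a ha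
  rw [heq _ hLa, heq _ ha]
  exact ((hℬ ψ).1 hψ).2 L a ha

omit [AddCommGroup V] [Module ℚ V] in
/-- **`(𝒟 ⊓ ℬ)|_A = 𝒟|_A ⊓ ℬ|_A`** in `Hom_ℚ(A, V)`: a common restriction of a member of `𝒟` and a member of `ℬ` is
the restriction of a central element (the member of `𝒟` itself). [cite: CurtisReiner1962, §59] -/
theorem map_domRestrict'_commutant_inf_bicommutant_eq [AddCommGroup V] [Module ℚ V] (T : ι → V →ₗ[ℚ] V)
    {𝒟 ℬ : Submodule ℚ (V →ₗ[ℚ] V)} {A : Submodule ℚ V}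
    (h𝒟 : ∀ L : V →ₗ[ℚ] V, L ∈ 𝒟 ↔ (∀ a ∈ A, L a ∈ A) ∧ ∀ (i : ι) (a : V), a ∈ A → L (T i a) = T i (L a))
    (hℬ : ∀ ψ : V →ₗ[ℚ] V, ψ ∈ ℬ ↔ (∀ a ∈ A, ψ a ∈ A) ∧
      ∀ (L : ↥𝒟) (a : V), a ∈ A → ψ ((L : V →ₗ[ℚ] V) a) = (L : V →ₗ[ℚ] V) (ψ a)) :
    (𝒟 ⊓ ℬ).map (LinearMap.domRestrict' A) = 𝒟.map (LinearMap.domRestrict' A) ⊓ ℬ.map (LinearMap.domRestrict' A) := by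
  refine le_antisymm (Submodule.map_inf_le _) ?_
  rintro f ⟨⟨z, hz, rfl⟩, ⟨ψ, hψ, hψf⟩⟩
  refine ⟨z, ⟨hz, mem_bicommutant_of_eqOn T h𝒟 hℬ hz hψ fun a ha => ?_⟩, rfl⟩
  have h := LinearMap.congr_fun hψf ⟨a, ha⟩
  rw [LinearMap.domRestrict'_apply, LinearMap.domRestrict'_apply] at h
  exact h.symm

/-- **THE CENTRE IS THE INTERSECTION OF THE OPERATOR ALGEBRA WITH ITS COMMUTANT: `(𝒟 ⊓ ℬ)|_A =
𝒟|_A ⊓ span(T)|_A`** (`A` finite-dimensional stable irreducible, `T` closed under composition with identity; K2's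
`ℬ|_A = span(T)|_A`). [cite: CurtisReiner1962, §59] [cite: Lang2002, XVII §3 Thm. 3.2] [cite: Herstein1994, §4] -/
theorem map_domRestrict'_centre_eq_inf_span {𝒟 ℬ : Submodule ℚ (V →ₗ[ℚ] V)} {A : Submodule ℚ V}
    [FiniteDimensional ℚ A]
    (h𝒟 : ∀ L : V →ₗ[ℚ] V, L ∈ 𝒟 ↔ (∀ a ∈ A, L a ∈ A) ∧ ∀ (i : ι) (a : V), a ∈ A → L (T i a) = T i (L a))
    (hℬ : ∀ ψ : V →ₗ[ℚ] V, ψ ∈ ℬ ↔ (∀ a ∈ A, ψ a ∈ A) ∧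
      ∀ (L : ↥𝒟) (a : V), a ∈ A → ψ ((L : V →ₗ[ℚ] V) a) = (L : V →ₗ[ℚ] V) (ψ a))
    (h1 : ∃ i₀ : ι, T i₀ = LinearMap.id) (hmul : ∀ i i' : ι, ∃ i'' : ι, T i'' = T i ∘ₗ T i')
    (hAst : ∀ (i : ι) (v : V), v ∈ A → T i v ∈ A)
    (hAirr : ∀ W : Submodule ℚ V, W ≤ A → W ≠ ⊥ → (∀ (i : ι) (v : V), v ∈ W → T i v ∈ W) → W = A) :
    (𝒟 ⊓ ℬ).map (LinearMap.domRestrict' A) =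
      𝒟.map (LinearMap.domRestrict' A) ⊓ (Submodule.span ℚ (Set.range T)).map (LinearMap.domRestrict' A) := by
  rw [map_domRestrict'_commutant_inf_bicommutant_eq T h𝒟 hℬ, map_domRestrict'_bicommutant_eq T h𝒟 hℬ h1 hmul hAst hAirr]

omit [AddCommGroup V] [Module ℚ V] in
/-- **AN ELEMENT OF `span(T)` IS CENTRAL IFF IT COMMUTES WITH THE OPERATORS ON `A`**: for `φ ∈ span(T)`,
`φ|_A ∈ (𝒟 ⊓ ℬ)|_A ⟺ ∀ i, ∀ a ∈ A, φ (T_i a) = T_i (φ a)` (`span(T) ≤ ℬ` always, K2).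
[cite: CurtisReiner1962, §59] [cite: Herstein1994, §4] -/
theorem domRestrict'_mem_centre_iff_of_mem_span [AddCommGroup V] [Module ℚ V] (T : ι → V →ₗ[ℚ] V)
    {𝒟 ℬ : Submodule ℚ (V →ₗ[ℚ] V)} {A : Submodule ℚ V}
    (h𝒟 : ∀ L : V →ₗ[ℚ] V, L ∈ 𝒟 ↔ (∀ a ∈ A, L a ∈ A) ∧ ∀ (i : ι) (a : V), a ∈ A → L (T i a) = T i (L a))
    (hℬ : ∀ ψ : V →ₗ[ℚ] V, ψ ∈ ℬ ↔ (∀ a ∈ A, ψ a ∈ A) ∧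
      ∀ (L : ↥𝒟) (a : V), a ∈ A → ψ ((L : V →ₗ[ℚ] V) a) = (L : V →ₗ[ℚ] V) (ψ a))
    (hAst : ∀ (i : ι) (v : V), v ∈ A → T i v ∈ A)
    {φ : V →ₗ[ℚ] V} (hφ : φ ∈ Submodule.span ℚ (Set.range T)) :
    LinearMap.domRestrict' A φ ∈ (𝒟 ⊓ ℬ).map (LinearMap.domRestrict' A) ↔
      ∀ (i : ι) (a : V), a ∈ A → φ (T i a) = T i (φ a) := by
  have hφA : ∀ a ∈ A, φ a ∈ A := fun a ha => apply_mem_of_mem_span_range T hAst hφ ha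
  constructor
  · rintro ⟨z, hz, hzφ⟩ i a ha
    have heq : ∀ a ∈ A, z a = φ a := fun a ha => by
      have h := LinearMap.congr_fun hzφ ⟨a, ha⟩
      rw [LinearMap.domRestrict'_apply, LinearMap.domRestrict'_apply] at h
      exact h
    rw [← heq _ (hAst i a ha), ← heq a ha]
    exact ((h𝒟 z).1 (Submodule.mem_inf.1 hz).1).2 i a ha
  · intro hcomm
    have hφ𝒟 : φ ∈ 𝒟 := (h𝒟 φ).2 ⟨hφA, hcomm⟩
    exact ⟨φ, ⟨hφ𝒟, mem_bicommutant_of_mem_span_range T h𝒟 hℬ hAst hφ⟩, rfl⟩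

/-! ### §2 Schur for the centre: `Z|_A` is a field -/

/-- A central element is zero on `A` or injective on `A` (it lies in `𝒟`; file C1).
[cite: Lang2002, XVII §1 Prop. 1.1] -/
theorem centre_zero_or_injOn {𝒟 ℬ : Submodule ℚ (V →ₗ[ℚ] V)} {A : Submodule ℚ V}
    (h𝒟 : ∀ L : V →ₗ[ℚ] V, L ∈ 𝒟 ↔ (∀ a ∈ A, L a ∈ A) ∧ ∀ (i : ι) (a : V), a ∈ A → L (T i a) = T i (L a))
    (hAst : ∀ (i : ι) (v : V), v ∈ A → T i v ∈ A)
    (hAirr : ∀ W : Submodule ℚ V, W ≤ A → W ≠ ⊥ → (∀ (i : ι) (v : V), v ∈ W → T i v ∈ W) → W = A)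
    {z : V →ₗ[ℚ] V} (hz : z ∈ 𝒟 ⊓ ℬ) : (∀ a ∈ A, z a = 0) ∨ ∀ a ∈ A, z a = 0 → a = 0 :=
  commutant_zero_or_injOn T h𝒟 hAst hAirr (Submodule.mem_inf.1 hz).1

/-- **A CENTRAL ELEMENT NON-ZERO ON `A` HAS AN INVERSE IN THE CENTRE**: its inverse in `𝒟` (file C1) again commutes
with `𝒟` on `A` (apply `z` and use injectivity).  So `Z|_A` is a (commutative) FIELD. [cite: Lang2002, XVII §1
Prop. 1.1] [cite: Herstein1994, §4] -/
theorem exists_centre_inverse {𝒟 ℬ : Submodule ℚ (V →ₗ[ℚ] V)} {A : Submodule ℚ V} [FiniteDimensional ℚ A]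
    (h𝒟 : ∀ L : V →ₗ[ℚ] V, L ∈ 𝒟 ↔ (∀ a ∈ A, L a ∈ A) ∧ ∀ (i : ι) (a : V), a ∈ A → L (T i a) = T i (L a))
    (hℬ : ∀ ψ : V →ₗ[ℚ] V, ψ ∈ ℬ ↔ (∀ a ∈ A, ψ a ∈ A) ∧
      ∀ (L : ↥𝒟) (a : V), a ∈ A → ψ ((L : V →ₗ[ℚ] V) a) = (L : V →ₗ[ℚ] V) (ψ a))
    (hAst : ∀ (i : ι) (v : V), v ∈ A → T i v ∈ A)
    (hAirr : ∀ W : Submodule ℚ V, W ≤ A → W ≠ ⊥ → (∀ (i : ι) (v : V), v ∈ W → T i v ∈ W) → W = A)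
    {z : V →ₗ[ℚ] V} (hz : z ∈ 𝒟 ⊓ ℬ) (hne : ¬ ∀ a ∈ A, z a = 0) :
    ∃ z' ∈ 𝒟 ⊓ ℬ, (∀ v, z' v ∈ A) ∧ (∀ a ∈ A, z' (z a) = a) ∧ ∀ a ∈ A, z (z' a) = a := by
  obtain ⟨hz𝒟, hzc⟩ := (mem_commutant_inf_bicommutant_iff T h𝒟 hℬ z).1 hz
  obtain ⟨z', hz'𝒟, hz'A, hleft, hright⟩ := exists_commutant_inverse T h𝒟 hAst hAirr hz𝒟 hne
  have hinj : ∀ a ∈ A, z a = 0 → a = 0 := (commutant_zero_or_injOn T h𝒟 hAst hAirr hz𝒟).resolve_left hne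
  refine ⟨z', (mem_commutant_inf_bicommutant_iff T h𝒟 hℬ z').2 ⟨hz'𝒟, fun L hL a ha => ?_⟩, hz'A, hleft, hright⟩
  -- `z (z' (L a) - L (z' a)) = L a - L a = 0`, and `z` is injective on `A`
  have hLa : L a ∈ A := ((h𝒟 L).1 hL).1 a ha
  have hLz'a : L (z' a) ∈ A := ((h𝒟 L).1 hL).1 _ (hz'A a)
  have hmem : z' (L a) - L (z' a) ∈ A := Submodule.sub_mem A (hz'A _) hLz'a
  have hzero : z (z' (L a) - L (z' a)) = 0 := by
    rw [map_sub, hright _ hLa, hzc L hL _ (hz'A a), hright a ha, sub_self]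
  exact sub_eq_zero.1 (hinj _ hmem hzero)

/-! ### §3 Commutative commutants lie inside the operator algebra -/

/-- **`𝒟|_A ≤ span(T)|_A ⟺ 𝒟` IS COMMUTATIVE ON `A`** (`A` finite-dimensional stable irreducible, `T` closed under
composition with identity): a commutative commutant commutes with itself, hence lies in `ℬ`, and `ℬ|_A = span(T)|_A`
(K2); conversely members of `span(T)` commute with `𝒟` on `A` (file C1).  On the CM side: the commutant of an
irreducible odd constituent `A ≤ ℚ^Y` is a FIELD iff it is realised inside the image of `ℚ[G]` on `A`.
[cite: CurtisReiner1962, §59] [cite: Lang2002, XVII §3 Thm. 3.2] [cite: Herstein1994, §4] -/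
theorem map_domRestrict'_commutant_le_span_iff_comm {𝒟 : Submodule ℚ (V →ₗ[ℚ] V)} {A : Submodule ℚ V}
    [FiniteDimensional ℚ A]
    (h𝒟 : ∀ L : V →ₗ[ℚ] V, L ∈ 𝒟 ↔ (∀ a ∈ A, L a ∈ A) ∧ ∀ (i : ι) (a : V), a ∈ A → L (T i a) = T i (L a))
    (h1 : ∃ i₀ : ι, T i₀ = LinearMap.id) (hmul : ∀ i i' : ι, ∃ i'' : ι, T i'' = T i ∘ₗ T i')
    (hAst : ∀ (i : ι) (v : V), v ∈ A → T i v ∈ A)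
    (hAirr : ∀ W : Submodule ℚ V, W ≤ A → W ≠ ⊥ → (∀ (i : ι) (v : V), v ∈ W → T i v ∈ W) → W = A) :
    𝒟.map (LinearMap.domRestrict' A) ≤ (Submodule.span ℚ (Set.range T)).map (LinearMap.domRestrict' A) ↔
      ∀ L ∈ 𝒟, ∀ L' ∈ 𝒟, ∀ a ∈ A, L (L' a) = L' (L a) := by
  constructor
  · intro hle L hL L' hL' a ha
    obtain ⟨φ, hφ, hφL⟩ := hle ⟨L, hL, rfl⟩
    have heq : ∀ a ∈ A, φ a = L a := fun a ha => by
      have h := LinearMap.congr_fun hφL ⟨a, ha⟩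
      rw [LinearMap.domRestrict'_apply, LinearMap.domRestrict'_apply] at h
      exact h
    have hL'a : L' a ∈ A := ((h𝒟 L').1 hL').1 a ha
    rw [← heq _ hL'a, ← heq a ha]
    exact (commutant_apply_comm_of_mem_span_range T h𝒟 hL' hφ ha).symm
  · intro hcomm
    rintro _ ⟨L, hL, rfl⟩
    obtain ⟨φ, hφ, hφL⟩ := exists_mem_span_range_eqOn_of_comm T h𝒟 h1 hmul hAst hAirr ((h𝒟 L).1 hL).1
      fun L' hL' a ha => hcomm L hL L' hL' a ha
    refine ⟨φ, hφ, LinearMap.ext fun a => ?_⟩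
    rw [LinearMap.domRestrict'_apply, LinearMap.domRestrict'_apply]
    exact hφL a a.2

omit [AddCommGroup V] [Module ℚ V] in
/-- **A COMMUTATIVE COMMUTANT IS ITS OWN CENTRE**: if `𝒟` is commutative on `A` then `𝒟 ≤ ℬ` and
`(𝒟 ⊓ ℬ)|_A = 𝒟|_A`. [cite: CurtisReiner1962, §59] [cite: Herstein1994, §4] -/
theorem map_domRestrict'_centre_eq_of_comm [AddCommGroup V] [Module ℚ V] (T : ι → V →ₗ[ℚ] V)
    {𝒟 ℬ : Submodule ℚ (V →ₗ[ℚ] V)} {A : Submodule ℚ V}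
    (h𝒟 : ∀ L : V →ₗ[ℚ] V, L ∈ 𝒟 ↔ (∀ a ∈ A, L a ∈ A) ∧ ∀ (i : ι) (a : V), a ∈ A → L (T i a) = T i (L a))
    (hℬ : ∀ ψ : V →ₗ[ℚ] V, ψ ∈ ℬ ↔ (∀ a ∈ A, ψ a ∈ A) ∧
      ∀ (L : ↥𝒟) (a : V), a ∈ A → ψ ((L : V →ₗ[ℚ] V) a) = (L : V →ₗ[ℚ] V) (ψ a))
    (hcomm : ∀ L ∈ 𝒟, ∀ L' ∈ 𝒟, ∀ a ∈ A, L (L' a) = L' (L a)) :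
    (𝒟 ⊓ ℬ).map (LinearMap.domRestrict' A) = 𝒟.map (LinearMap.domRestrict' A) := by
  have hle : 𝒟 ≤ ℬ := fun L hL =>
    (hℬ L).2 ⟨((h𝒟 L).1 hL).1, fun L' a ha => hcomm L hL L' L'.2 a ha⟩
  rw [inf_eq_left.2 hle]

omit [AddCommGroup V] [Module ℚ V] in
/-- `𝒟|_A` is finite-dimensional (its members are maps `A → V` with values in the finite-dimensional `A`).
[folklore] -/
theorem finite_map_domRestrict'_commutant [AddCommGroup V] [Module ℚ V] (T : ι → V →ₗ[ℚ] V)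
    {𝒟 : Submodule ℚ (V →ₗ[ℚ] V)} {A : Submodule ℚ V} [FiniteDimensional ℚ A]
    (h𝒟 : ∀ L : V →ₗ[ℚ] V, L ∈ 𝒟 ↔ (∀ a ∈ A, L a ∈ A) ∧ ∀ (i : ι) (a : V), a ∈ A → L (T i a) = T i (L a)) :
    Module.Finite ℚ ↥(𝒟.map (LinearMap.domRestrict' A)) := by
  let post : (A →ₗ[ℚ] A) →ₗ[ℚ] (A →ₗ[ℚ] V) :=
    { toFun := fun g => A.subtype ∘ₗ g
      map_add' := fun g g' => LinearMap.ext fun a => by simp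
      map_smul' := fun t g => LinearMap.ext fun a => by simp }
  haveI : Module.Finite ℚ ↥((⊤ : Submodule ℚ (A →ₗ[ℚ] A)).map post) := Module.Finite.map _ _
  refine Submodule.finiteDimensional_of_le (fun f hf => ?_ :
    𝒟.map (LinearMap.domRestrict' A) ≤ (⊤ : Submodule ℚ (A →ₗ[ℚ] A)).map post)
  obtain ⟨L, hL, rfl⟩ := hf
  refine ⟨L.restrict fun a ha => ((h𝒟 L).1 hL).1 a ha, trivial, LinearMap.ext fun a => ?_⟩
  rfl

/-- **`dim Z|_A ≤ δ`** (`Z|_A ≤ 𝒟|_A`, and K1's `dim 𝒟|_A = δ` for `0 ≠ a₀ ∈ A`). [cite: Lang2002, XVII §1] -/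
theorem finrank_map_domRestrict'_centre_le {𝒟 ℬ : Submodule ℚ (V →ₗ[ℚ] V)} {A : Submodule ℚ V}
    [FiniteDimensional ℚ A]
    (h𝒟 : ∀ L : V →ₗ[ℚ] V, L ∈ 𝒟 ↔ (∀ a ∈ A, L a ∈ A) ∧ ∀ (i : ι) (a : V), a ∈ A → L (T i a) = T i (L a))
    (hAst : ∀ (i : ι) (v : V), v ∈ A → T i v ∈ A)
    (hAirr : ∀ W : Submodule ℚ V, W ≤ A → W ≠ ⊥ → (∀ (i : ι) (v : V), v ∈ W → T i v ∈ W) → W = A)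
    {a₀ : V} (ha₀ : a₀ ∈ A) (h0 : a₀ ≠ 0) :
    Module.finrank ℚ ↥((𝒟 ⊓ ℬ).map (LinearMap.domRestrict' A)) ≤
      Module.finrank ℚ ↥(𝒟.map (LinearMap.applyₗ a₀)) := by
  rw [← finrank_map_domRestrict'_commutant_eq T h𝒟 hAst hAirr ha₀ h0]
  haveI := finite_map_domRestrict'_commutant T (A := A) h𝒟
  exact Submodule.finrank_mono (Submodule.map_mono inf_le_left)

/-- **`dim Z|_A ≤ dim span(T)|_A`** (`Z|_A ≤ ℬ|_A = span(T)|_A`, finite-dimensional by K2).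
[cite: Lang2002, XVII §3 Cor. 3.5] -/
theorem finrank_map_domRestrict'_centre_le_span {𝒟 ℬ : Submodule ℚ (V →ₗ[ℚ] V)} {A : Submodule ℚ V}
    [FiniteDimensional ℚ A]
    (h𝒟 : ∀ L : V →ₗ[ℚ] V, L ∈ 𝒟 ↔ (∀ a ∈ A, L a ∈ A) ∧ ∀ (i : ι) (a : V), a ∈ A → L (T i a) = T i (L a))
    (hℬ : ∀ ψ : V →ₗ[ℚ] V, ψ ∈ ℬ ↔ (∀ a ∈ A, ψ a ∈ A) ∧
      ∀ (L : ↥𝒟) (a : V), a ∈ A → ψ ((L : V →ₗ[ℚ] V) a) = (L : V →ₗ[ℚ] V) (ψ a))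
    (h1 : ∃ i₀ : ι, T i₀ = LinearMap.id) (hmul : ∀ i i' : ι, ∃ i'' : ι, T i'' = T i ∘ₗ T i')
    (hAst : ∀ (i : ι) (v : V), v ∈ A → T i v ∈ A)
    (hAirr : ∀ W : Submodule ℚ V, W ≤ A → W ≠ ⊥ → (∀ (i : ι) (v : V), v ∈ W → T i v ∈ W) → W = A) :
    Module.finrank ℚ ↥((𝒟 ⊓ ℬ).map (LinearMap.domRestrict' A)) ≤
      Module.finrank ℚ ↥((Submodule.span ℚ (Set.range T)).map (LinearMap.domRestrict' A)) := by
  haveI := finite_map_domRestrict'_span T (A := A) hAst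
  rw [map_domRestrict'_centre_eq_inf_span T h𝒟 hℬ h1 hmul hAst hAirr]
  exact Submodule.finrank_mono inf_le_right

end Summit.HodgeConjecture.CorCM.IrrOdd

end
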